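import Literature.Probability.RandomPlanarGeometry.SLERestrictionTwoSided
import Literature.Probability.RandomPlanarGeometry.SLERestrictionSmooth
import Literature.Probability.RandomPlanarGeometry.HullDecomposition
import Literature.Probability.RandomPlanarGeometry.HullSubordination
import Literature.Probability.RandomPlanarGeometry.RestrictionSubadditivity
import Literature.Probability.RandomPlanarGeometry.LoewnerRealPointProofs
import Literature.Probability.RandomPlanarGeometry.LoewnerInverse
import Literature.Probability.RandomPlanarGeometry.RestrictionSemigroup
import Literature.Probability.RandomPlanarGeometry.RestrictionHullsProofs
import HarnessLib

/-!
# Slid hulls are `*`-hulls; domination of the restriction martingales; the assembly of [LSW] Thm. 6.1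

Complement to `SLERestrictionTwoSided` (plan in `SLERestrictionMartingale`), after

* G. F. Lawler, O. Schramm, W. Werner, *Conformal restriction: the chordal case*, J. Amer. Math.
  Soc. **16** (2003) 917–955, arXiv:math/0209343 (**[LSW]**), §5 ("Suppose that `A ∈ 𝒬*` is
  fixed … For `t < T`, let `A_t = g_t(A)` … `h_t := g̃_t ∘ g_A ∘ g_t⁻¹ = g_{A_t}`") and the proof
  of Lemma 6.2 ("Since `g_B'(W)` is invariant under scaling `B` about `W`, under translating
  `B` and `W`, and is monotone decreasing in `B`").

Contents:

* `Literature.Probability.RandomPlanarGeometry.Loewner.IsGeneratedByCurve.isStarHull_slidHull` — PROVED: **the slid hull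
  `A_t − W_t = (g_t − W_t)(A)` of a `*`-hull `A` is a `*`-hull**, for a chain driven by `W`
  (`W_0 = 0`) generated by a simple curve `γ` with `γ[0, t] ∩ A = ∅` (the setting of [LSW] §5
  before the hitting time, where `g_{A_t}` is used): `A` lies in the open set of points still
  flowing at time `t` (real points of `A` are off the closed hull `γ[0,t]`,
  `lt_swallowingTime_of_notMem_closure_hull_holds`), where `g_t` is continuous and injective,
  real on real points and `ℍ`-valued on `ℍ`; so `A_t − W_t` is compact, the closure of its part
  in `ℍ`, misses `0 = g_t(·) − W_t` (no point of `A` is swallowed), and its complement in `ℍ`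
  is the conformal image under `g_t − W_t` of `ℍ ∖ (γ(0,t] ∪ A)`, itself conformally equivalent
  by `Φ_A` to `ℍ` minus the arc `Φ_A(γ[0,t])` hanging from `0`, which is simply connected
  (`isConnected_upperHalfPlaneSet_diff_arc` of `HalfPlaneArc` and Conway's criterion
  `isSimplyConnected_of_isConnected_compl_holds`).
* `Literature.Probability.RandomPlanarGeometry.sle_restrictionDeriv_dominated_of_subset` — PROVED: the domination hypothesis `hdom`
  of `sle_restriction_eightThirds_of_facts`, from the monotonicity of `B ↦ Φ'_B(0)` on `𝒬*`
  quoted above from [LSW] (the tree's `HasRestrictionDeriv.le_of_subset`, `HullSubordination`)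
  at the slid hulls, which are `*`-hulls by the first result, along the a.s. simple SLE_{8/3}
  trace.
* `Literature.Probability.RandomPlanarGeometry.sle_restrictionDeriv_frequently_gt_of_union` — PROVED: the lim-sup property
  `sle_restrictionDeriv_frequently_gt A` for a TWO-SIDED hull `A = A₊ ∪ A₋`, from [LSW]
  Lemma 6.2 for `A₊` (`h62`) and for `A₋` (by reflection, `LoewnerReflection`) at the same exit
  times `T(r)` and the subadditivity `1 − Φ'_{B₊ ∪ B₋}(0) ≤ (1 − Φ'_{B₊}(0)) + (1 − Φ'_{B₋}(0))`
  at the slid hulls (`HasRestrictionDeriv.one_sub_le_add`, `RestrictionSubadditivity`; in [LSW]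
  the union bound for the excursion of Prop. 4.1).
* `Literature.Probability.RandomPlanarGeometry.sle_restriction_eightThirds_of_facts` — the assembly of `sle_restriction_eightThirds`
  from the one-sided theorem (`SLERestrictionSmooth`), the two-sided assembly
  (`SLERestrictionTwoSided`) and an abstract domination hypothesis `hdom`; and
* `Literature.Probability.RandomPlanarGeometry.sle_restriction_eightThirds_of_printed_facts` — the assembly of
  `sle_restriction_eightThirds` ([LSW] Thm. 6.1) from printed statements only: [LSW] Prop.
  5.2/5.3 (`hM`), Lemmas 6.2, 6.3, 2.1 (`h62`, `h63`, `h21`), existence/uniqueness of `Φ_A`,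
  `Φ'_A(0)` (`huniq`, `hex`, proved in the tree) and the Rohde–Schramm / Lawler facts on the
  trace (`hgen`, `h₆`, `htr`, `hswallow`, `hmeas` — the last proved in the tree,
  `aemeasurable_sleTrace_holds`).
-/

noncomputable section

open Set Filter Topology MeasureTheory Metric Complex
open UpperHalfPlane (upperHalfPlaneSet isOpen_upperHalfPlaneSet)
open scoped NNReal ENNReal

namespace Literature.Probability.RandomPlanarGeometry

namespace Loewner

variable {W : ℝ≥0 → ℝ} {γ : ℝ≥0 → ℂ} {A : Set ℂ}

/-! ### Points of a hull avoided by the curve are still flowing -/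

/-- For a chain generated by a simple curve, a point of a hull `A ⊆ ℍ̄` missed by `γ[0, t]`
is still flowing at time `t`: points of `ℍ` off `K_t = γ(0, t]` by definition, real points off
the closed hull `γ[0, t]` by `lt_swallowingTime_of_notMem_closure_hull`. [folklore] -/
theorem IsGeneratedByCurve.lt_swallowingTime_of_disjoint (hW : Continuous W)
    (hγ : IsGeneratedByCurve W γ) (hs : IsSimpleTrace γ) (hA : IsBoundedHull A) {t : ℝ≥0}
    (hdisj : Disjoint (γ '' Icc 0 t) A) {a : ℂ} (ha : a ∈ A) :
    (t : WithTop ℝ≥0) < swallowingTime W a := by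
  have him : 0 ≤ a.im := by
    have := hA.subset_closure ha
    rwa [show upperHalfPlaneSet = {z : ℂ | 0 < z.im} from rfl, Complex.closure_setOf_lt_im] at this
  have hnot : a ∉ γ '' Icc 0 t := fun h ↦ Set.disjoint_left.1 hdisj h ha
  rcases him.lt_or_eq with hpos | hzero
  · -- `a ∈ ℍ ∖ K_t`
    by_contra hle
    push Not at hle
    have : a ∈ hull W t := ⟨hpos, hle⟩
    rw [hγ.hull_eq_image hs t] at this
    exact hnot (image_mono Ioc_subset_Icc_self this)
  · -- `a` real, off the closed hull `γ[0, t]`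
    have hare : ((a.re : ℝ) : ℂ) = a := Complex.ext (by simp) (by simp [← hzero])
    have h0 : ((a.re : ℝ) : ℂ) ≠ W 0 := by
      rw [hare]
      intro h
      apply hnot
      refine ⟨0, ⟨le_rfl, bot_le⟩, ?_⟩
      rw [hγ.apply_zero, ← h]
    have hcl : ((a.re : ℝ) : ℂ) ∉ closure (hull W t) := by
      rw [hare, hγ.hull_eq_image hs t]
      intro h
      have hsub : closure (γ '' Ioc (0 : ℝ≥0) t) ⊆ γ '' Icc 0 t :=
        closure_minimal (image_mono Ioc_subset_Icc_self)
          ((isCompact_Icc.image hγ.continuous).isClosed)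
      exact hnot (hsub h)
    have := lt_swallowingTime_of_notMem_closure_hull_holds hW h0 hcl
    rwa [hare] at this

/-! ### The slid hull of a `*`-hull is a `*`-hull -/

/-- **The slid hull `A_t − W_t` is a `*`-hull** ([LSW] §5: `A_t = g_t(A)`, `h_t = g_{A_t}`,
`t < T`), for a chain with `W_0 = 0` generated by a simple curve `γ` with `γ[0,t] ∩ A = ∅`,
`A ∈ 𝒬*` with a restriction map `Φ` (used to see that `ℍ ∖ (γ(0,t] ∪ A) ≅ ℍ ∖ Φ(γ[0,t])` is
simply connected). [cite: LawlerSchrammWerner2003Restriction, §5 (A_t = g_t(A) ∈ 𝒬*, h_t = g_{A_t})] -/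
theorem IsGeneratedByCurve.isStarHull_slidHull (hW : Continuous W) (hW0 : W 0 = 0)
    (hγ : IsGeneratedByCurve W γ) (hs : IsSimpleTrace γ) (hA : IsStarHull A)
    {Φ : ConformalEquiv (upperHalfPlaneSet \ A) upperHalfPlaneSet} (hΦ : IsRestrictionMap A Φ)
    {t : ℝ≥0} (hdisj : Disjoint (γ '' Icc 0 t) A) : IsStarHull (slidHull W A t) := by
  classical
  have hAb := hA.isBoundedHull
  have hAc : IsClosed A := hAb.isClosed
  have hAcpt : IsCompact A := hAb.isCompact
  set g : ℂ → ℂ := map W t with hg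
  set c : ℂ := (W t : ℂ) with hc
  set B : Set ℂ := slidHull W A t with hB
  have hBdef : B = (fun a ↦ g a - c) '' A := rfl
  -- every point of `A` is still flowing
  have hAT : ∀ a ∈ A, (t : WithTop ℝ≥0) < swallowingTime W a := fun a ha ↦
    hγ.lt_swallowingTime_of_disjoint hW hs hAb hdisj ha
  have him0 : ∀ a ∈ A, 0 ≤ a.im := fun a ha ↦ by
    have := hAb.subset_closure ha
    rwa [show upperHalfPlaneSet = {z : ℂ | 0 < z.im} from rfl, Complex.closure_setOf_lt_im] at this
  -- continuity and injectivity of `g` on `A`, values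
  have hcontA : ContinuousOn (fun a ↦ g a - c) A := fun a ha ↦
    ((continuousAt_map hW (hAT a ha)).sub continuousAt_const).continuousWithinAt
  have hinj : InjOn g {z : ℂ | (t : WithTop ℝ≥0) < swallowingTime W z} :=
    injOn_map_of_lt_swallowingTime hW t
  have hreal : ∀ a ∈ A, a.im = 0 → (g a).im = 0 ∧ g a ≠ c := by
    intro a ha ha0
    obtain ⟨G, hG⟩ := exists_isSolution_swallowingTime_holds hW (ne_driving_of_lt_swallowingTime (hAT a ha))
    have hmap : g a = G t := map_eq_of_isSolution hW hG (hAT a ha)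
    have htT : ((t : ℝ).toNNReal : WithTop ℝ≥0) < swallowingTime W a := by
      rw [Real.toNNReal_coe]; exact hAT a ha
    refine ⟨?_, ?_⟩
    · rw [hmap]
      exact IsSolution.im_eq_zero_holds hG ha0 t t.2 htT
    · rw [hmap, hc]
      have := hG.ne t.2 htT
      simpa [Real.toNNReal_coe] using this
  have hpos : ∀ a ∈ A, 0 < a.im → 0 < (g a).im := fun a ha hapos ↦
    mapsTo_map hW t ((mem_domain_iff W t a).2 ⟨hapos, hAT a ha⟩)
  -- compactness
  have hBcpt : IsCompact B := hAcpt.image_of_continuousOn hcontA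
  -- the part in `ℍ`
  have hBH : B ∩ upperHalfPlaneSet = (fun a ↦ g a - c) '' (A ∩ upperHalfPlaneSet) := by
    ext b
    constructor
    · rintro ⟨⟨a, ha, rfl⟩, hb⟩
      refine ⟨a, ⟨ha, ?_⟩, rfl⟩
      rcases (him0 a ha).lt_or_eq with h | h
      · exact h
      · exfalso
        have : (g a - c).im = 0 := by rw [Complex.sub_im, (hreal a ha h.symm).1, hc, Complex.ofReal_im, sub_zero]
        exact absurd this (ne_of_gt hb)
    · rintro ⟨a, ⟨ha, haH⟩, rfl⟩
      refine ⟨⟨a, ha, rfl⟩, ?_⟩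
      show 0 < (g a - c).im
      rw [Complex.sub_im, hc, Complex.ofReal_im, sub_zero]
      exact hpos a ha haH
  refine ⟨⟨hBcpt.isBounded, ?_, ?_⟩, ?_⟩
  · -- `closure (B ∩ ℍ) = B`
    rw [hBH]
    refine Subset.antisymm (closure_minimal (image_mono inter_subset_left) hBcpt.isClosed) ?_
    rintro _ ⟨a, ha, rfl⟩
    have hacl : a ∈ closure (A ∩ upperHalfPlaneSet) := by rw [hAb.closure_inter_eq]; exact ha
    exact ((hcontA a ha).mono inter_subset_left).mem_closure_image hacl
  · -- simple connectivity of `ℍ ∖ B`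
    -- the domain `S = ℍ ∖ (γ(0,t] ∪ A)` and its image `S' = Φ(S) = ℍ ∖ Λ`
    set S : Set ℂ := domain W t \ A with hS
    have hSsub : S ⊆ upperHalfPlaneSet \ A := fun z hz ↦ ⟨hz.1.1, hz.2⟩
    have hdom : domain W t = upperHalfPlaneSet \ γ '' Ioc 0 t := by
      rw [domain, hγ.hull_eq_image hs t]
    have hγHA : ∀ r : ℝ≥0, 0 < r → r ≤ t → γ r ∈ upperHalfPlaneSet \ A := fun r hr hrt ↦
      ⟨hs.2 r hr, fun h ↦ Set.disjoint_left.1 hdisj ⟨r, ⟨bot_le, hrt⟩, rfl⟩ h⟩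
    -- the arc `Λ = Φ(γ(0,t]) ∪ {0}`
    set γt : ℝ≥0 → ℂ := fun r ↦ if r = 0 then 0 else Φ (γ r) with hγt
    set Λ : Set ℂ := γt '' Icc 0 t with hΛ
    have hγt0 : γt 0 = 0 := by simp [hγt]
    have hγtpos : ∀ r : ℝ≥0, r ≠ 0 → γt r = Φ (γ r) := fun r hr ↦ by simp [hγt, hr]
    have hΛmem : ∀ {w : ℂ}, w ∈ Λ ↔ w = 0 ∨ ∃ r : ℝ≥0, 0 < r ∧ r ≤ t ∧ w = Φ (γ r) := by
      intro w
      constructor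
      · rintro ⟨r, ⟨-, hrt⟩, rfl⟩
        rcases eq_or_ne r 0 with rfl | hr
        · exact Or.inl hγt0
        · exact Or.inr ⟨r, pos_iff_ne_zero.2 hr, hrt, hγtpos r hr⟩
      · rintro (rfl | ⟨r, hr, hrt, rfl⟩)
        · exact ⟨0, ⟨le_rfl, bot_le⟩, hγt0⟩
        · exact ⟨r, ⟨bot_le, hrt⟩, hγtpos r hr.ne'⟩
    have hS' : Φ '' S = upperHalfPlaneSet \ Λ := by
      ext w
      constructor
      · rintro ⟨z, hz, rfl⟩
        have hzHA : z ∈ upperHalfPlaneSet \ A := hSsub hz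
        refine ⟨Φ.mapsTo hzHA, fun hw ↦ ?_⟩
        rcases hΛmem.1 hw with h0 | ⟨r, hr, hrt, hw'⟩
        · exact absurd (Φ.mapsTo hzHA) (by rw [h0]; simp)
        · have hzr : z = γ r := Φ.injOn hzHA (hγHA r hr hrt) hw'
          have : z ∈ domain W t := hz.1
          rw [hdom] at this
          exact this.2 ⟨r, ⟨hr, hrt⟩, hzr.symm⟩
      · rintro ⟨hw, hwΛ⟩
        refine ⟨Φ.symm w, ⟨?_, ?_⟩, Φ.apply_symm_apply hw⟩
        · rw [hdom]
          refine ⟨(Φ.symm_mapsTo hw).1, ?_⟩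
          rintro ⟨r, ⟨hr, hrt⟩, hr'⟩
          apply hwΛ
          rw [hΛmem]
          exact Or.inr ⟨r, hr, hrt, by rw [hr', Φ.apply_symm_apply hw]⟩
        · exact (Φ.symm_mapsTo hw).2
    have hmaps : MapsTo Φ S (upperHalfPlaneSet \ Λ) := fun z hz ↦ hS' ▸ mem_image_of_mem _ hz
    have hmaps' : MapsTo Φ.symm (upperHalfPlaneSet \ Λ) S := by
      intro w hw
      rw [← hS'] at hw
      obtain ⟨z, hz, rfl⟩ := hw
      rwa [Φ.symm_apply_apply (hSsub hz)]
    -- continuity and injectivity of the arc parametrisation on `[0, t]`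
    have hUopen : IsOpen (upperHalfPlaneSet \ A) := isOpen_upperHalfPlaneSet.sdiff hAc
    have hΛcont : ContinuousOn γt (Icc 0 t) := by
      intro r hr
      rcases eq_or_ne r 0 with rfl | hr0
      · -- at `0`: `Φ(γ r) → 0` as `r → 0⁺`
        rcases eq_or_ne t 0 with rfl | ht0
        · rw [Icc_self]
          exact continuousWithinAt_singleton
        have h1 : Tendsto γ (𝓝[>] (0 : ℝ≥0)) (𝓝[upperHalfPlaneSet \ A] 0) := by
          refine tendsto_nhdsWithin_iff.2 ⟨?_, ?_⟩
          · have := hγ.continuous.tendsto 0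
            rw [hγ.apply_zero, hW0, Complex.ofReal_zero] at this
            exact this.mono_left nhdsWithin_le_nhds
          · have hmem : Ioc (0 : ℝ≥0) t ∈ 𝓝[>] (0 : ℝ≥0) :=
              Ioc_mem_nhdsGT (pos_iff_ne_zero.2 ht0)
            filter_upwards [hmem] with r hr
            exact hγHA r hr.1 hr.2
        have h2 : Tendsto (fun r ↦ Φ (γ r)) (𝓝[>] (0 : ℝ≥0)) (𝓝 0) := hΦ.1.comp h1
        have h3 : Tendsto γt (𝓝[>] (0 : ℝ≥0)) (𝓝 0) :=
          h2.congr' (eventually_mem_nhdsWithin.mono fun r hr ↦ (hγtpos r (ne_of_gt hr)).symm)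
        have hset : ({0}ᶜ : Set ℝ≥0) = Ioi 0 := by
          ext r
          simp [pos_iff_ne_zero]
        have h4 : Tendsto γt (𝓝 (0 : ℝ≥0)) (𝓝 0) := by
          rw [← nhdsNE_sup_pure (0 : ℝ≥0), hset]
          exact tendsto_sup.2 ⟨h3, tendsto_pure_left.2 fun s hs ↦ by
            rw [hγt0]; exact mem_of_mem_nhds hs⟩
        rw [ContinuousWithinAt, hγt0]
        exact h4.mono_left nhdsWithin_le_nhds
      · have hrpos : 0 < r := pos_iff_ne_zero.2 hr0
        have hca : ContinuousAt (fun r ↦ Φ (γ r)) r :=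
          ((Φ.continuousOn _ (hγHA r hrpos hr.2)).continuousAt
            (hUopen.mem_nhds (hγHA r hrpos hr.2))).comp (hγ.continuous.continuousAt)
        have heq : γt =ᶠ[𝓝 r] fun r ↦ Φ (γ r) := by
          filter_upwards [isOpen_ne.mem_nhds hr0] with r' hr'
          exact hγtpos r' hr'
        exact (hca.congr heq.symm).continuousWithinAt
    have hΛinj : InjOn γt (Icc 0 t) := by
      intro r₁ hr₁ r₂ hr₂ heq
      rcases eq_or_ne r₁ 0 with rfl | h₁ <;> rcases eq_or_ne r₂ 0 with rfl | h₂
      · rfl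
      · exfalso
        rw [hγt0, hγtpos r₂ h₂] at heq
        have := Φ.mapsTo (hγHA r₂ (pos_iff_ne_zero.2 h₂) hr₂.2)
        rw [← heq] at this
        simp at this
      · exfalso
        rw [hγt0, hγtpos r₁ h₁] at heq
        have := Φ.mapsTo (hγHA r₁ (pos_iff_ne_zero.2 h₁) hr₁.2)
        rw [heq] at this
        simp at this
      · rw [hγtpos r₁ h₁, hγtpos r₂ h₂] at heq
        exact hs.1 (Φ.injOn (hγHA r₁ (pos_iff_ne_zero.2 h₁) hr₁.2)
          (hγHA r₂ (pos_iff_ne_zero.2 h₂) hr₂.2) heq)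
    have hΛcpt : IsCompact Λ := isCompact_Icc.image_of_continuousOn hΛcont
    have h0Λ : (0 : ℂ) ∈ Λ := ⟨0, ⟨le_rfl, bot_le⟩, hγt0⟩
    -- `ℍ ∖ Λ` is connected
    have hconn : IsConnected (upperHalfPlaneSet \ Λ) := by
      rcases eq_or_ne t 0 with rfl | ht0
      · have : Λ = {0} := by
          rw [hΛ, Icc_self, image_singleton, hγt0]
        rw [this, sdiff_eq_left.2 (by
          rw [disjoint_singleton_right]
          simp [upperHalfPlaneSet])]
        exact ((convex_halfSpace_im_gt 0).isPathConnected ⟨Complex.I, by simp⟩).isConnected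
      · -- parametrise `Λ` by `[0, 1]`
        have ht0' : (0 : ℝ≥0) < t := pos_iff_ne_zero.2 ht0
        have hmemI : ∀ s : unitInterval, unitInterval.toNNReal s * t ∈ Icc (0 : ℝ≥0) t := fun s ↦
          ⟨bot_le, by
            rw [← NNReal.coe_le_coe, NNReal.coe_mul, unitInterval.coe_toNNReal]
            exact mul_le_of_le_one_left t.2 s.2.2⟩
        set f : unitInterval → Λ := fun s ↦
          ⟨γt (unitInterval.toNNReal s * t), mem_image_of_mem _ (hmemI s)⟩ with hf
        have hfc : Continuous f := by
          refine continuous_induced_rng.2 ?_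
          exact hΛcont.comp_continuous (unitInterval.toNNReal_continuous.mul continuous_const) hmemI
        have hfinj : Function.Injective f := fun s s' h ↦
          Literature.Topology.PlaneTopology.unitInterval.toNNReal_injective
            (mul_right_cancel₀ ht0 (hΛinj (hmemI s) (hmemI s') (congrArg Subtype.val h)))
        have hfsurj : Function.Surjective f := by
          rintro ⟨_, ⟨u, hu, rfl⟩⟩
          have hut : (u : ℝ) / t ≤ 1 := by
            rw [div_le_one (by exact_mod_cast ht0')]
            exact_mod_cast hu.2
          refine ⟨⟨(u : ℝ) / t, div_nonneg u.2 t.2, hut⟩, Subtype.ext ?_⟩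
          show γt (unitInterval.toNNReal ⟨(u : ℝ) / t, _⟩ * t) = γt u
          congr 1
          ext
          rw [NNReal.coe_mul, unitInterval.coe_toNNReal]
          exact div_mul_cancel₀ _ (by exact_mod_cast ht0)
        let e : unitInterval ≃ₜ Λ :=
          Continuous.homeoOfEquivCompactToT2 (f := Equiv.ofBijective f ⟨hfinj, hfsurj⟩) hfc
        refine Literature.Topology.PlaneTopology.isConnected_upperHalfPlaneSet_diff_arc e ?_ fun s hs' ↦ ?_
        · show (γt (unitInterval.toNNReal 0 * t)).im = 0
          rw [unitInterval.toNNReal_zero, zero_mul, hγt0, Complex.zero_im]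
        · show 0 < (γt (unitInterval.toNNReal s * t)).im
          have hne : unitInterval.toNNReal s * t ≠ 0 := by
            refine mul_ne_zero ?_ ht0
            intro h
            apply hs'
            apply Literature.Topology.PlaneTopology.unitInterval.toNNReal_injective
            rw [h, unitInterval.toNNReal_zero]
          rw [hγtpos _ hne]
          exact Φ.mapsTo (hγHA _ (pos_iff_ne_zero.2 hne) (hmemI s).2)
    -- hence simply connected (Conway's criterion)
    have hsc' : IsSimplyConnected (upperHalfPlaneSet \ Λ) := by
      refine isSimplyConnected_of_isConnected_compl_holds
        (isOpen_upperHalfPlaneSet.sdiff hΛcpt.isClosed) hconn ?_ ?_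
      · have hcompl : (upperHalfPlaneSet \ Λ)ᶜ = Λ ∪ {z : ℂ | z.im ≤ 0} := by
          ext z
          simp only [mem_compl_iff, Set.mem_sdiff, mem_union, mem_setOf_eq, upperHalfPlaneSet,
            not_and, not_not]
          constructor
          · intro h
            by_cases hz : 0 < z.im
            · exact Or.inl (h hz)
            · exact Or.inr (not_lt.1 hz)
          · rintro (h | h) hz
            · exact h
            · exact absurd hz (not_lt.2 h)
        rw [hcompl]
        exact IsConnected.union ⟨0, h0Λ, show (0 : ℂ) ∈ {z : ℂ | z.im ≤ 0} by simp⟩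
          ((isConnected_Icc bot_le).image _ hΛcont) isConnected_setOf_im_nonpos
      · intro hb
        obtain ⟨R, hR⟩ := (hb.subset (show {z : ℂ | z.im ≤ 0} ⊆ (upperHalfPlaneSet \ Λ)ᶜ from
          fun z hz h ↦ absurd (show 0 < z.im from h.1) (not_lt.2 hz))).subset_closedBall 0
        have := hR (show (-((|R| + 1 : ℝ) : ℂ) * Complex.I) ∈ {z : ℂ | z.im ≤ 0} by
          simp only [mem_setOf_eq, neg_mul, Complex.neg_im, Complex.mul_im, Complex.ofReal_re,
            Complex.I_im, mul_one, Complex.ofReal_im, Complex.I_re, mul_zero, add_zero]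
          linarith [abs_nonneg R])
        rw [mem_closedBall_zero_iff, norm_mul, norm_neg, Complex.norm_real, Complex.norm_I, mul_one,
          Real.norm_of_nonneg (by positivity)] at this
        linarith [le_abs_self R]
    -- transport to `S`, then to `ℍ ∖ g(A)`, then translate
    have hscS : IsSimplyConnected S :=
      (Φ.restr S (upperHalfPlaneSet \ Λ) hSsub sdiff_subset hmaps hmaps').isSimplyConnected_iff.2 hsc'
    set G : ConformalEquiv (domain W t) upperHalfPlaneSet := conformalEquivMap hW t with hGdef
    have hV : MapsTo G S (upperHalfPlaneSet \ g '' A) := by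
      intro z hz
      refine ⟨mapsTo_map hW t hz.1, ?_⟩
      rintro ⟨a, ha, haz⟩
      have : a = z := hinj (hAT a ha) ((mem_domain_iff W t z).1 hz.1).2 haz
      exact hz.2 (this ▸ ha)
    have hV' : MapsTo G.symm (upperHalfPlaneSet \ g '' A) S := by
      intro w hw
      refine ⟨G.symm_mapsTo hw.1, fun ha ↦ hw.2 ⟨_, ha, ?_⟩⟩
      exact G.apply_symm_apply hw.1
    have hscV : IsSimplyConnected (upperHalfPlaneSet \ g '' A) :=
      (G.restr S (upperHalfPlaneSet \ g '' A) sdiff_subset sdiff_subset hV hV').isSimplyConnected_iff.1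
        hscS
    have htrans : upperHalfPlaneSet \ B = (Homeomorph.addRight (-c)) '' (upperHalfPlaneSet \ g '' A) := by
      ext w
      simp only [Homeomorph.coe_addRight, image_add_right, neg_neg, mem_preimage, Set.mem_sdiff,
        hBdef, mem_image, not_exists, not_and]
      have hcim : (w + c).im = w.im := by rw [Complex.add_im, hc, Complex.ofReal_im, add_zero]
      constructor
      · rintro ⟨hw, hwB⟩
        exact ⟨by rw [show upperHalfPlaneSet = {z : ℂ | 0 < z.im} from rfl, mem_setOf_eq, hcim]; exact hw,
          fun a ha haw ↦ hwB a ha (by rw [haw, add_sub_cancel_right])⟩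
      · rintro ⟨hw, hwB⟩
        refine ⟨by
          rw [show upperHalfPlaneSet = {z : ℂ | 0 < z.im} from rfl, mem_setOf_eq, hcim] at hw; exact hw,
          fun a ha haw ↦ hwB a ha (by rw [← haw, sub_add_cancel])⟩
    rw [htrans]
    exact (Homeomorph.addRight (-c)).isSimplyConnected_image.2 hscV
  · -- `0 ∉ B`
    rintro ⟨a, ha, ha0⟩
    have ha0' : g a = c := sub_eq_zero.1 ha0
    rcases (him0 a ha).lt_or_eq with h | h
    · have := hpos a ha h
      rw [ha0', hc, Complex.ofReal_im] at this
      exact lt_irrefl _ this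
    · exact (hreal a ha h.symm).2 ha0'

end Loewner

/-! ### The domination hypothesis from monotonicity -/

/-- **Domination along the SLE_{8/3} flow**: for `*`-hulls `A' ⊆ A`, almost surely, before
the hitting time of `A` the slid hulls `A_t − W_t ⊇ A'_t − W_t` are `*`-hulls
(`Loewner.IsGeneratedByCurve.isStarHull_slidHull`, on the a.s. event where the chain is
generated by the simple trace, `hgen`, `h₆`), so the monotonicity of `Φ'(0)` in the hull
(`HasRestrictionDeriv.le_of_subset` of `HullSubordination`; [LSW] proof of Lemma 6.2: "`g_B'(W)`
… is monotone decreasing in `B`") applies: this discharges the hypothesis `hdom` of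
`sle_restriction_eightThirds_of_facts`. [folklore] -/
theorem sle_restrictionDeriv_dominated_of_subset
    (huniq : IsStarHull.existsUnique_isRestrictionMap) (hgen : HasSLETrace ((8 : ℝ≥0) / 3))
    (h₆ : RandomPlanarGeometry.ae_isSimpleTrace_sleTrace_of_le_four (κ := (8 : ℝ≥0) / 3)) {A A' : Set ℂ}
    (hA : IsStarHull A) (hA' : IsStarHull A') (hsub : A' ⊆ A) :
    sle_restrictionDeriv_dominated A A' := by
  have hκ0 : (0 : ℝ≥0) < 8 / 3 := by positivity
  have hκ4 : (8 : ℝ≥0) / 3 ≤ 4 := by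
    rw [div_le_iff₀ (by norm_num : (0 : ℝ≥0) < 3)]
    norm_num
  obtain ⟨Φ, hΦ, -⟩ := huniq hA
  obtain ⟨Φ', hΦ', -⟩ := huniq hA'
  filter_upwards [ae_isGeneratedByCurve_sleTrace hgen, h₆ hκ0 hκ4] with ω hgenω hsω t ht Ψ e Ψ' e'
    hΨ he hΨ' he'
  have hW : Continuous (sleDriving ((8 : ℝ≥0) / 3) ω) := continuous_sleDriving _ ω
  have hW0 : sleDriving ((8 : ℝ≥0) / 3) ω 0 = 0 := sleDriving_zero _ _
  have hdisj : ∀ {B : Set ℂ}, (t : WithTop ℝ≥0) < firstHit (sleTrace ((8 : ℝ≥0) / 3) ω) B →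
      Disjoint (sleTrace ((8 : ℝ≥0) / 3) ω '' Icc 0 t) B := by
    intro B hB
    refine Set.disjoint_left.2 ?_
    rintro _ ⟨s, hs, rfl⟩ hsB
    exact notMem_of_lt_firstHit (lt_of_le_of_lt (WithTop.coe_le_coe.2 hs.2) hB) hsB
  have ht' : (t : WithTop ℝ≥0) < firstHit (sleTrace ((8 : ℝ≥0) / 3) ω) A' :=
    ht.trans_le (firstHit_mono _ hsub)
  have hB : IsStarHull (Loewner.slidHull (sleDriving ((8 : ℝ≥0) / 3) ω) A t) :=
    hgenω.isStarHull_slidHull hW hW0 hsω hA hΦ (hdisj ht)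
  have hB' : IsStarHull (Loewner.slidHull (sleDriving ((8 : ℝ≥0) / 3) ω) A' t) :=
    hgenω.isStarHull_slidHull hW hW0 hsω hA' hΦ' (hdisj ht')
  exact HasRestrictionDeriv.le_of_subset hB hB' (image_mono hsub) hΨ hΨ' he he'

/-! ### The lim-sup property of a two-sided hull from Lemma 6.2 for its side parts -/

/-- Slid hulls of a union. [folklore] -/
theorem Loewner.slidHull_union (W : ℝ≥0 → ℝ) (A A' : Set ℂ) (t : ℝ≥0) :
    Loewner.slidHull W (A ∪ A') t = Loewner.slidHull W A t ∪ Loewner.slidHull W A' t :=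
  image_union _ _ _

/-- **[LSW] Lemma 6.2 for SLE_{8/3} and a two-sided hull `A = A₊ ∪ A₋`: the lim-sup property
`sle_restrictionDeriv_frequently_gt A`** (Lawler (2005) p. 161: "`lim sup_{t→∞} M_t^{8/5} = 1`
on the event `V_A`", printed there for smooth Jordan hulls of `𝒬₊`). Almost surely, on the
event that the trace never hits `A`, at every exit time `T(r)` with `r` large BOTH slid side
parts satisfy `Φ'(0) > 1 − ε/2` ([LSW] Lemma 6.2 for `A₊ ∈ 𝒬₊`, `restrictionDeriv_exitTime_gt`,
and for `A₋ ∈ 𝒬₋` by reflection, `restrictionDeriv_exitTime_gt_of_isMinusHull`); the slid hull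
of `A` is the union of the slid parts, all three are `*`-hulls
(`IsGeneratedByCurve.isStarHull_slidHull`), so the subadditivity
`1 − Φ'_{B₊ ∪ B₋}(0) ≤ (1 − Φ'_{B₊}(0)) + (1 − Φ'_{B₋}(0))` (`HasRestrictionDeriv.one_sub_le_add`,
`RestrictionSubadditivity`; in [LSW] the union bound behind Prop. 4.1) gives `Φ'(0) > 1 − ε`
for the slid hull of `A`; exit times beyond any given time exist (`exists_isExitTime_ge`).
[cite: LawlerSchrammWerner2003Restriction, Lemma 6.2 and proof of Thm. 6.1 (§6), with Prop. 4.1] -/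
theorem sle_restrictionDeriv_frequently_gt_of_union
    (huniq : IsStarHull.existsUnique_isRestrictionMap)
    (h62 : Loewner.restrictionDeriv_exitTime_gt) (hgen : HasSLETrace ((8 : ℝ≥0) / 3))
    (h₆ : RandomPlanarGeometry.ae_isSimpleTrace_sleTrace_of_le_four (κ := (8 : ℝ≥0) / 3))
    (htr : tendsto_norm_sleTrace_atTop) (hswallow : sle_swallowingTime_ofReal_eq_firstHit)
    {A Ap Am : Set ℂ} (hA : IsStarHull A) (hAp : IsPlusHull Ap) (hAm : IsMinusHull Am)
    (hunion : Ap ∪ Am = A) : sle_restrictionDeriv_frequently_gt A := by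
  have hκ0 : (0 : ℝ≥0) < 8 / 3 := by positivity
  have hκ4 : (8 : ℝ≥0) / 3 ≤ 4 := by
    rw [div_le_iff₀ (by norm_num : (0 : ℝ≥0) < 3)]
    norm_num
  obtain ⟨Φ, hΦ, -⟩ := huniq hA
  obtain ⟨Φp, hΦp, -⟩ := huniq hAp.1
  obtain ⟨Φm, hΦm, -⟩ := huniq hAm.1
  filter_upwards [ae_isGeneratedByCurve_sleTrace hgen, h₆ hκ0 hκ4, htr hκ0] with ω hgenω hsω htrω
    hT ε hε
  set W := sleDriving ((8 : ℝ≥0) / 3) ω with hWdef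
  have hW : Continuous W := continuous_sleDriving _ ω
  have hW0 : W 0 = 0 := sleDriving_zero _ _
  have hγA : Disjoint (range (sleTrace ((8 : ℝ≥0) / 3) ω)) A := firstHit_eq_top_iff_disjoint.1 hT
  have hγp : Disjoint (range (sleTrace ((8 : ℝ≥0) / 3) ω)) Ap :=
    hγA.mono_right (hunion ▸ subset_union_left)
  have hγm : Disjoint (range (sleTrace ((8 : ℝ≥0) / 3) ω)) Am :=
    hγA.mono_right (hunion ▸ subset_union_right)
  have hε2 : 0 < ε / 2 := by linarith
  obtain ⟨r₁, hr₁⟩ := h62 hW hAp (disjoint_closedHull hswallow hgenω hsω hγp) (ε / 2) hε2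
  obtain ⟨r₂, hr₂⟩ := Loewner.restrictionDeriv_exitTime_gt_of_isMinusHull h62 hW hAm
    (disjoint_closedHull hswallow hgenω hsω hγm) hε2
  rw [frequently_atTop]
  intro a
  obtain ⟨r, hr, t, hat, ht⟩ := exists_isExitTime_ge hswallow hgenω hsω htrω a (max r₁ r₂)
  refine ⟨t, hat, fun Ψ e hΨ he ↦ ?_⟩
  -- the three slid hulls are `*`-hulls, the slid hull of `A` being the union of the others
  have hdj : ∀ {B : Set ℂ}, Disjoint (range (sleTrace ((8 : ℝ≥0) / 3) ω)) B →
      Disjoint (sleTrace ((8 : ℝ≥0) / 3) ω '' Icc 0 t) B := fun h ↦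
    h.mono_left (image_subset_range _ _)
  have hB : IsStarHull (Loewner.slidHull W A t) := hgenω.isStarHull_slidHull hW hW0 hsω hA hΦ (hdj hγA)
  have hBp : IsStarHull (Loewner.slidHull W Ap t) :=
    hgenω.isStarHull_slidHull hW hW0 hsω hAp.1 hΦp (hdj hγp)
  have hBm : IsStarHull (Loewner.slidHull W Am t) :=
    hgenω.isStarHull_slidHull hW hW0 hsω hAm.1 hΦm (hdj hγm)
  have hBunion : Loewner.slidHull W Ap t ∪ Loewner.slidHull W Am t = Loewner.slidHull W A t := by
    rw [← Loewner.slidHull_union, hunion]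
  -- restriction data of the slid parts, and Lemma 6.2 for each
  obtain ⟨Ψp, hΨp, -⟩ := huniq hBp
  obtain ⟨ep, -, -, hep⟩ := IsStarHull.exists_hasRestrictionDeriv_holds hBp hΨp
  obtain ⟨Ψm, hΨm, -⟩ := huniq hBm
  obtain ⟨em, -, -, hem⟩ := IsStarHull.exists_hasRestrictionDeriv_holds hBm hΨm
  have h1 : 1 - ε / 2 < ep := hr₁ r ((le_max_left _ _).trans hr) t ht Ψp ep hΨp hep
  have h2 : 1 - ε / 2 < em := hr₂ r ((le_max_right _ _).trans hr) t ht Ψm em hΨm hem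
  -- subadditivity
  have hsub := HasRestrictionDeriv.one_sub_le_add hBp hBm hB hBunion hΨp hΨm hΨ hep hem he
  linarith

/-! ### Assembly: `sle_restriction_eightThirds` from the printed facts -/

/-- **[LSW] Thm. 6.1 (`sle_restriction_eightThirds`) from its ingredients.** For `A ∈ 𝒬*`
write `A = A₊ ⊔ A₋` (`IsStarHull.sidePart_decomposition`). If one part is empty, `A` is
one-sided and `SLERestrictionSmooth` applies ([LSW]'s printed route: Prop. 5.2/5.3 `hM`,
Lemma 6.2 `h62`, Lemma 6.3 `h63`, Lemma 2.1 `h21`). Otherwise both parts are nonempty one-sided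
`*`-hulls with restriction data (`huniq`, `hex`) for which Thm. 6.1 holds, and
`sle_measure_disjoint_eq_of_sideParts` applies with the lim-sup property of `A`
(`sle_restrictionDeriv_frequently_gt_of_union`: Lemma 6.2 for both parts and subadditivity)
and the domination hypothesis (`hdom`, monotonicity of `Φ'` at slid hulls).
[cite: LawlerSchrammWerner2003Restriction, Thm. 6.1 and its proof (§6)] -/
theorem sle_restriction_eightThirds_of_facts [Fact Process.isProjectiveLimit_preWienerMeasure]
    (huniq : IsStarHull.existsUnique_isRestrictionMap) (hex : IsStarHull.exists_hasRestrictionDeriv)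
    (hM : sle_exists_isRestrictionMartingale)
    (h62 : Loewner.restrictionDeriv_exitTime_gt) (h63 : IsSmoothHull.restrictionDerivVanishesAtHit)
    (h21 : IsPlusHull.exists_antitone_isSmoothHull)
    (hdom : ∀ {A A' : Set ℂ}, IsStarHull A → IsStarHull A' → A' ⊆ A →
      sle_restrictionDeriv_dominated A A')
    (hgen : HasSLETrace ((8 : ℝ≥0) / 3))
    (h₆ : RandomPlanarGeometry.ae_isSimpleTrace_sleTrace_of_le_four (κ := (8 : ℝ≥0) / 3))
    (htr : tendsto_norm_sleTrace_atTop) (hswallow : sle_swallowingTime_ofReal_eq_firstHit)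
    (hmeas : ∀ t : ℝ≥0, AEMeasurable (fun ω ↦ sleTrace ((8 : ℝ≥0) / 3) ω t) Process.preWienerMeasure) :
    sle_restriction_eightThirds := by
  intro A hA Φ hΦ d hd
  have one_sided : ∀ {B : Set ℂ}, IsPlusHull B ∨ IsMinusHull B →
      ∀ {Ψ : ConformalEquiv (upperHalfPlaneSet \ B) upperHalfPlaneSet}, IsRestrictionMap B Ψ →
        ∀ {e : ℝ}, HasRestrictionDeriv B Ψ e →
          Process.preWienerMeasure {ω | Disjoint (range (sleTrace ((8 : ℝ≥0) / 3) ω)) B} =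
            ENNReal.ofReal (e ^ ((5 : ℝ) / 8)) := fun hB _ hΨ _ he ↦
    sle_measure_disjoint_eq_of_isPlusHull_or_isMinusHull huniq hex hM h62 h63 h21 hgen h₆ htr
      hswallow hB hΨ he
  -- the `±`-decomposition
  have hnf := hA.isBoundedHull.isConnected_union_im_nonpos
  obtain ⟨hP, hMi, hunion, -, -, -⟩ := hA.sidePart_decomposition hnf
  set Ap := sidePart A 1 with hAp
  set Am := sidePart A (-1) with hAm
  rcases Am.eq_empty_or_nonempty with hm0 | hnem
  · -- `A = A₊` is a `+`-hull
    have hAeq : Ap = A := by rw [← hunion, hm0, union_empty]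
    exact one_sided (Or.inl (hAeq ▸ hP)) hΦ hd
  rcases Ap.eq_empty_or_nonempty with hp0 | hnep
  · -- `A = A₋` is a `−`-hull
    have hAeq : Am = A := by rw [← hunion, hp0, empty_union]
    exact one_sided (Or.inr (hAeq ▸ hMi)) hΦ hd
  -- two-sided: data and martingales for the parts
  obtain ⟨Φp, hΦp, -⟩ := huniq hP.1
  obtain ⟨dp, -, -, hdp⟩ := hex hP.1 hΦp
  obtain ⟨Φm, hΦm, -⟩ := huniq hMi.1
  obtain ⟨dm, -, -, hdm⟩ := hex hMi.1 hΦm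
  obtain ⟨Y, hY⟩ := hM hA
  obtain ⟨Yp, hYp⟩ := hM hP.1
  obtain ⟨Ym, hYm⟩ := hM hMi.1
  exact sle_measure_disjoint_eq_of_sideParts huniq hex hmeas hA hunion hP.1 hMi.1 hY hYp hYm
    (sle_restrictionDeriv_frequently_gt_of_union huniq h62 hgen h₆ htr hswallow hA hP hMi hunion)
    (sle_restrictionDeriv_frequently_gt_of_isPlusHull_or_isMinusHull h62 hgen h₆ htr hswallow
      (Or.inl hP))
    (sle_restrictionDeriv_frequently_gt_of_isPlusHull_or_isMinusHull h62 hgen h₆ htr hswallow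
      (Or.inr hMi))
    hΦp hdp (one_sided (Or.inl hP) hΦp hdp) hΦm hdm (one_sided (Or.inr hMi) hΦm hdm)
    (hdom hA hP.1 (hunion ▸ subset_union_left)) (hdom hA hMi.1 (hunion ▸ subset_union_right))
    hΦ hd

/-! ### [LSW] Thm. 6.1 from printed statements -/

/-- **[LSW] Thm. 6.1 (`sle_restriction_eightThirds`) from printed statements only**: as
`sle_restriction_eightThirds_of_facts` (`SLERestrictionTwoSided`), with the domination
hypothesis discharged (monotonicity of `Φ'(0)`, proved above). Inputs:
[LSW] Prop. 5.2/5.3 (`hM`), Lemma 6.2 (`h62`), Lemma 6.3 (`h63`), Lemma 2.1 (`h21`);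
existence/uniqueness of `Φ_A`
and `Φ'_A(0)` (`huniq`, `hex`: `IsStarHull.existsUnique_isRestrictionMap_holds`,
`IsStarHull.exists_hasRestrictionDeriv_holds`); Rohde–Schramm: the SLE_{8/3} chain is generated
by a transient simple curve (`hgen`, `h₆`, `htr`), Lawler's identification of swallowing with
hitting (`hswallow`), marginal measurability of the trace (`hmeas`: `aemeasurable_sleTrace_holds`);
and that the pre-Wiener measure is a probability measure (the `Fact`, Wiener's theorem).
[cite: LawlerSchrammWerner2003Restriction, Thm. 6.1 and its proof (§6)] -/
theorem sle_restriction_eightThirds_of_printed_facts [Fact Process.isProjectiveLimit_preWienerMeasure]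
    (huniq : IsStarHull.existsUnique_isRestrictionMap) (hex : IsStarHull.exists_hasRestrictionDeriv)
    (hM : sle_exists_isRestrictionMartingale)
    (h62 : Loewner.restrictionDeriv_exitTime_gt) (h63 : IsSmoothHull.restrictionDerivVanishesAtHit)
    (h21 : IsPlusHull.exists_antitone_isSmoothHull)
    (hgen : HasSLETrace ((8 : ℝ≥0) / 3))
    (h₆ : RandomPlanarGeometry.ae_isSimpleTrace_sleTrace_of_le_four (κ := (8 : ℝ≥0) / 3))
    (htr : tendsto_norm_sleTrace_atTop) (hswallow : sle_swallowingTime_ofReal_eq_firstHit)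
    (hmeas : ∀ t : ℝ≥0, AEMeasurable (fun ω ↦ sleTrace ((8 : ℝ≥0) / 3) ω t) Process.preWienerMeasure) :
    sle_restriction_eightThirds :=
  sle_restriction_eightThirds_of_facts huniq hex hM h62 h63 h21
    (fun hA hA' hsub ↦ sle_restrictionDeriv_dominated_of_subset huniq hgen h₆ hA hA' hsub)
    hgen h₆ htr hswallow hmeas

end Literature.Probability.RandomPlanarGeometry

end
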